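import Literature.AlgebraicGeometry.AbelianVarieties.AbelianVarietyWeilDivisorBundleDictionary
import Literature.AlgebraicGeometry.Modules.DetClassOfIso
import Literature.AlgebraicGeometry.Motives.AbelianVarietyPicZeroOfAmpleAnyField
import HarnessLib

/-!
# Every homogeneous line bundle on an abelian variety over `Ω = Ω̄`, `char Ω = 0`, is a Mumford bundle `t_a^*𝒪(Θ) ⊗ 𝒪(Θ)⁻¹`
# ([MumfordAV1970] §8 Theorem 1 in MODULE currency)

Layer `Literature/AlgebraicGeometry/AbelianVarieties`, namespace `Literature.AlgebraicGeometry.AbelianVarieties`.  THEOREMS ONLY (no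
definition, no named fact, no instance, no notation).  The (H0) consumer pack (cell `hodgecm-mathlib`, F-3 (M)∕(Mc) book, input of the
N3′ level-0 port): the divisor-currency head ★ `AbelianVariety.exists_linEquiv_weilDiv_of_forall_translate_linEquiv_of_isAlgClosed`
(`Motives/AbelianVarietyPicZeroOfAmpleAnyField`) read for MODULES — for `X` an abelian variety over an algebraically closed field `Ω`
of characteristic `0`, `Θ` ample and `E` a rank-one module with `IsHomogeneous X E` (`t_x^*E ≅ E` for all `x ∈ X(Ω)`, [MumfordAV1970]
§8 (iv)):

* **`exists_nonempty_iso_translateTensorDual_of_isHomogeneous`** — `E ≅ t_a^*𝒪(Θ) ⊗ 𝒪(Θ)⁻¹` for some `a ∈ X(Ω)` (the ★ ℂ road of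
  `AbelianSchemes/PolarizationOntoComplexPoints` §1 token for token with the ℂ-head replaced: `E ≅ 𝒪(D₀)` with `t_x^*D₀ ∼ D₀`, ★
  `isHomogeneous_iff_exists_iso_lineBundle`; `D₀ ∼ t_a^*Θ − Θ`; classes ★ `detClass_translateTensorDual_eq_cechClass_weilDiv`, ★
  `nonempty_iso_iff_detClass_eq`);
* **`exists_detClass_eq_cechClass_weilDiv_of_isHomogeneous`** — the same in class form: `[E] = [𝒪(t_a^*Θ − Θ)]` in `Ȟ¹(X, 𝒪^×)`;
* **`exists_nonempty_iso_lineBundle_weilDiv_of_isHomogeneous`** — `E ≅ 𝒪(t_a^*Θ − Θ)`.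

HC_CM is proved only modulo the 7 printed citations until rung 0 closes; nothing here bears on a summit statement.

## References
* [MumfordAV1970] D. Mumford, *Abelian Varieties* (1970), §8 Theorem 1 (p. 77), §8 (i)–(iv) (pp. 74–75).
* [MumfordFogartyKirwan1994] D. Mumford, J. Fogarty, F. Kirwan, *Geometric Invariant Theory*, 3rd ed. (1994), Ch. 6 §2 Def. 6.2 (p. 120).
* [GortzWedhorn2020] U. Görtz, T. Wedhorn, *Algebraic Geometry I*, 2nd ed. (2020), Prop. 11.21 (p. 374).
-/

set_option autoImplicit false

noncomputable section

open CategoryTheory CategoryTheory.Limits AlgebraicGeometry MonoidalCategory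

namespace Literature.AlgebraicGeometry.AbelianVarieties

open Literature.AlgebraicGeometry.Motives Literature.AlgebraicGeometry.Modules
open scoped MonObj

variable {Ω : Type} [Field Ω] [IsAlgClosed Ω] [CharZero Ω] (X : AbelianVariety Ω) {Θ : CartierDivisor X.X.left}

/-- **[E] = [𝒪(t_a^*Θ − Θ)] for every rank-one homogeneous `E`** (`Ω` algebraically closed of characteristic `0`, `Θ` ample):
`E ≅ 𝒪(D₀)` with `D₀` translation-invariant (★ `isHomogeneous_iff_exists_iso_lineBundle`), and `D₀ ∼ t_a^*Θ − Θ` by [MumfordAV1970]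
§8 Theorem 1 over `Ω` (★ `exists_linEquiv_weilDiv_of_forall_translate_linEquiv_of_isAlgClosed`).
[cite: MumfordAV1970, §8 Theorem 1 (p. 77)] -/
theorem exists_detClass_eq_cechClass_weilDiv_of_isHomogeneous (hΘ : Θ.IsAmple) {E : X.X.left.Modules} (hE1 : HasRank E 1)
    (hhom : IsHomogeneous X E) :
    ∃ a : X.Points Ω, detClass (HasRank.isFiniteLocallyFree' hE1) = (X.weilDiv Θ a).cechClass := by
  -- `E ≅ 𝒪(D₀)` with `t_x^* D₀ ∼ D₀` for every `x`
  obtain ⟨D₀, -, ⟨φ⟩⟩ := (isHomogeneous_iff_exists_iso_lineBundle X hE1).1 hhom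
  have hD₀ : ∀ x : X.Points Ω, (D₀.pullback (X.translation x).left).LinEquiv D₀ :=
    (isHomogeneous_iff_forall_linEquiv_of_iso X φ).1 hhom
  -- Mumford §8 Theorem 1 over `Ω`: `D₀ ∼ t_a^*Θ − Θ`
  obtain ⟨a, ha⟩ := X.exists_linEquiv_weilDiv_of_forall_translate_linEquiv_of_isAlgClosed hΘ D₀ hD₀
  refine ⟨a, ?_⟩
  rw [detClass_eq_cechClass_of_iso φ (HasRank.isFiniteLocallyFree' hE1)]
  exact ha.cechClass_eq

/-- **Every rank-one homogeneous `E` is a Mumford bundle: `E ≅ t_a^*𝒪(Θ) ⊗ 𝒪(Θ)⁻¹`** for some `a ∈ X(Ω)` (`Ω = Ω̄`, `char Ω = 0`,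
`Θ` ample) — the module form of [MumfordAV1970] §8 Theorem 1 «`Pic⁰(X) = φ_Θ(X(Ω))`»; classes by ★
`detClass_translateTensorDual_eq_cechClass_weilDiv` and ★ `nonempty_iso_iff_detClass_eq`.
[cite: MumfordAV1970, §8 Theorem 1 (p. 77)] [cite: MumfordFogartyKirwan1994, Ch. 6 §2 Definition 6.2 (p. 120)] -/
theorem exists_nonempty_iso_translateTensorDual_of_isHomogeneous (hΘ : Θ.IsAmple) {E : X.X.left.Modules} (hE1 : HasRank E 1)
    (hhom : IsHomogeneous X E) :
    ∃ a : X.Points Ω, Nonempty (E ≅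
      tensorObj ((Scheme.Modules.pullback (X.translation a).left).obj (lineBundle Θ.toUnitCocycle))
        (Modules.dual (lineBundle Θ.toUnitCocycle))) := by
  obtain ⟨a, ha⟩ := exists_detClass_eq_cechClass_weilDiv_of_isHomogeneous X hΘ hE1 hhom
  refine ⟨a, ?_⟩
  have hM1 : HasRank (tensorObj ((Scheme.Modules.pullback (X.translation a).left).obj (lineBundle Θ.toUnitCocycle))
      (Modules.dual (lineBundle Θ.toUnitCocycle))) 1 :=
    hasRank_tensorObj_one (hasRank_pullback _ Θ.toUnitCocycle.hasRank_lineBundle)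
      (hasRank_dual Θ.toUnitCocycle.hasRank_lineBundle)
  refine (nonempty_iso_iff_detClass_eq hE1 hM1 (HasRank.isFiniteLocallyFree' hE1) (HasRank.isFiniteLocallyFree' hM1)).2 ?_
  rw [ha, detClass_translateTensorDual_eq_cechClass_weilDiv X Θ a]

/-- **`E ≅ 𝒪(t_a^*Θ − Θ)`** for some `a ∈ X(Ω)`, for every rank-one homogeneous `E` (`Ω = Ω̄`, `char Ω = 0`, `Θ` ample).
[cite: MumfordAV1970, §8 Theorem 1 (p. 77)] -/
theorem exists_nonempty_iso_lineBundle_weilDiv_of_isHomogeneous (hΘ : Θ.IsAmple) {E : X.X.left.Modules} (hE1 : HasRank E 1)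
    (hhom : IsHomogeneous X E) :
    ∃ a : X.Points Ω, Nonempty (E ≅ lineBundle (X.weilDiv Θ a).toUnitCocycle) := by
  obtain ⟨a, ha⟩ := exists_detClass_eq_cechClass_weilDiv_of_isHomogeneous X hΘ hE1 hhom
  refine ⟨a, (nonempty_iso_iff_detClass_eq hE1 (X.weilDiv Θ a).toUnitCocycle.hasRank_lineBundle
    (HasRank.isFiniteLocallyFree' hE1) (X.weilDiv Θ a).toUnitCocycle.isFiniteLocallyFree_lineBundle).2 ?_⟩
  rw [ha, (X.weilDiv Θ a).toUnitCocycle.detClass_lineBundle]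
  rfl

end Literature.AlgebraicGeometry.AbelianVarieties

end
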